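import Summits.MatrixMultiplication.OmegaCensus.ThreeSetZ4Z4Orders
import Summits.MatrixMultiplication.OmegaCensus.ThreeSetWZ4Z4CellsTPP
import HarnessLib

/-!
# The `ℤ₄²`-quotient column below `2080`: no dihedral-like law for any `A ↠ ℤ₄ × ℤ₄` with `|A| < 2080`

ω-census `pub-omega`, family (b3), seat pub-omega-group gen 17.  Framing: lottery ticket; floor = certified bounds/negative
ranges.  VALUE: kernel theorems about the group-theoretic method (TPP capacity of dihedral-like groups); NOT progress on ω.

`no_mod_one_law_of_onto_z4z4_nine_escapes` is the factorisation criterion with all kernel escapes now available over `ℤ₄²`-quotients: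
a part `1` (uniform domino theorem, gen 16), two parts `3` (gen 14), and the pairs `{3,5}, {5,5}, {7,7}` (type-`Y` tables) and
`{3,7}, {3,9}, {5,7}, {5,9}` (type-`W` tables) of gen 17.  `cube_factor_of_lt_2080` (`decide`): every factorisation `cde` with
`3cde + 1 < 2080`, `16 ∣ 3cde + 1` meets one of them — the first order escaping is `2080 = 3·693 + 1`, `693 = 3·11·21 = 7·9·11`.
CAPSTONE **`no_mod_one_law_of_onto_z4z4_card_lt_2080`**: for every finite abelian `A ↠ ℤ₄ × ℤ₄` with `|A| < 2080`, no
dihedral-like group over `A` (any `c₀`) has a TPP triple attaining `3|S||T||U| + 8 = 8|A|`.  Orders newly closed beyond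
`ThreeSetZ4Z4Orders.lean` (`< 1072`): `1072 = 3·(3·7·17)+1`, `1216 = 3·405+1` (`(3,9,15)`, `(5,9,9)`, `(3,3,45)`, `(3,5,27)`), and all
other `16 ∣ n ≡ 1 (3)` up to `2032`; instances `ℤ₄²×ℤ₆₇` (`1072`), `ℤ₄×ℤ₃₀₄`, `ℤ₈×ℤ₁₅₂` (`1216`), `ℤ₄²×ℤ₁₂₇` (`2032`).
-/

namespace Summit.MatrixMultiplication.OmegaCensus

open Finset

section DihedralLike

variable {A : Type} [AddCommGroup A] [DecidableEq A] [Fintype A] {G : Type} [Group G] [DecidableEq G]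
  {ρ τ : A → G} {c₀ : A} {S T U : Finset G}

open Literature.Combinatorics.Additive

/-- **Factorisation criterion with nine escapes.**  For `A ↠ ℤ₄ × ℤ₄`, `|A| ≥ 14`: if every factorisation `cde = (|A|−1)/3` has
a part `1`, or two parts among `{3,3}, {3,5}, {5,5}, {7,7}, {3,7}, {3,9}, {5,7}, {5,9}`, then no dihedral-like group over `A`
(any `c₀`) has a TPP triple attaining `3|S||T||U| + 8 = 8|A|`. [folklore] -/
theorem no_mod_one_law_of_onto_z4z4_nine_escapes
    (hρρ : ∀ a b, ρ a * ρ b = ρ (a + b)) (hρτ : ∀ a b, ρ a * τ b = τ (b - a))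
    (hτρ : ∀ a b, τ a * ρ b = τ (a + b)) (hττ : ∀ a b, τ a * τ b = ρ (c₀ + b - a))
    (hρ : Function.Injective ρ) (hτ : Function.Injective τ) (hne : ∀ a b, ρ a ≠ τ b)
    (hsurj : ∀ g, (∃ a, ρ a = g) ∨ (∃ a, τ a = g)) (hA : 14 ≤ Fintype.card A)
    (φ : A →+ ZMod 4 × ZMod 4) (hφ : Function.Surjective φ)
    (hq : ∀ c d e : ℕ, 3 * (c * d * e) + 1 = Fintype.card A →
      ((c = 1 ∨ d = 1 ∨ e = 1) ∨ ((c = 3 ∧ d = 3) ∨ (d = 3 ∧ e = 3) ∨ (c = 3 ∧ e = 3)) ∨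
      ((c = 3 ∧ d = 5) ∨ (d = 3 ∧ e = 5) ∨ (e = 3 ∧ c = 5) ∨ (c = 5 ∧ d = 3) ∨ (d = 5 ∧ e = 3) ∨ (e = 5 ∧ c = 3)) ∨
      ((c = 5 ∧ d = 5) ∨ (d = 5 ∧ e = 5) ∨ (e = 5 ∧ c = 5)) ∨ ((c = 7 ∧ d = 7) ∨ (d = 7 ∧ e = 7) ∨ (e = 7 ∧ c = 7)) ∨
      ((c = 3 ∧ d = 7) ∨ (d = 3 ∧ e = 7) ∨ (e = 3 ∧ c = 7) ∨ (c = 7 ∧ d = 3) ∨ (d = 7 ∧ e = 3) ∨ (e = 7 ∧ c = 3)) ∨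
      ((c = 3 ∧ d = 9) ∨ (d = 3 ∧ e = 9) ∨ (e = 3 ∧ c = 9) ∨ (c = 9 ∧ d = 3) ∨ (d = 9 ∧ e = 3) ∨ (e = 9 ∧ c = 3)) ∨
      ((c = 5 ∧ d = 7) ∨ (d = 5 ∧ e = 7) ∨ (e = 5 ∧ c = 7) ∨ (c = 7 ∧ d = 5) ∨ (d = 7 ∧ e = 5) ∨ (e = 7 ∧ c = 5)) ∨
      ((c = 5 ∧ d = 9) ∨ (d = 5 ∧ e = 9) ∨ (e = 5 ∧ c = 9) ∨ (c = 9 ∧ d = 5) ∨ (d = 9 ∧ e = 5) ∨ (e = 9 ∧ c = 5))))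
    (h : TripleProductProperty S T U) : 3 * (S.card * T.card * U.card) + 8 ≠ 8 * Fintype.card A := by
  intro hV
  have hmod : Fintype.card A % 3 = 1 := by omega
  by_cases hnc : ((univ.filter fun a : A => ρ a ∈ S).card = (univ.filter fun a : A => τ a ∈ S).card ∧
      (univ.filter fun a : A => ρ a ∈ T).card = (univ.filter fun a : A => τ a ∈ T).card ∧
      (univ.filter fun a : A => ρ a ∈ U).card = (univ.filter fun a : A => τ a ∈ U).card)
  · obtain ⟨hS', hT', hU'⟩ := hnc
    have cS := card_eq_parts' hρ hτ hne hsurj S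
    have cT := card_eq_parts' hρ hτ hne hsurj T
    have cU := card_eq_parts' hρ hτ hne hsurj U
    set s₀ := (univ.filter fun a : A => ρ a ∈ S).card with hs₀
    set t₀ := (univ.filter fun a : A => ρ a ∈ T).card with ht₀
    set u₀ := (univ.filter fun a : A => ρ a ∈ U).card with hu₀
    have eS : S.card = 2 * s₀ := by rw [cS, ← hS']; ring
    have eT : T.card = 2 * t₀ := by rw [cT, ← hT']; ring
    have eU : U.card = 2 * u₀ := by rw [cU, ← hU']; ring
    have hprod : 3 * (s₀ * t₀ * u₀) + 1 = Fintype.card A := by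
      rw [eS, eT, eU] at hV; nlinarith
    rcases hq s₀ t₀ u₀ hprod with h1 | (⟨h3, h3'⟩ | ⟨h3, h3'⟩ | ⟨h3, h3'⟩) | h35 | h55 | h77 | h37 | h39 | h57 | h59
    · exact no_law_cube_one_of_onto_z4z4 hρρ hρτ hτρ hττ hρ hτ hne hsurj φ hφ h hS' hT' hU' h1 hV
    · exact no_law_cube_33e_of_onto_z4z4 hρρ hρτ hτρ hττ hρ hτ hne hsurj φ hφ h h3 (hS' ▸ h3) h3' (hT' ▸ h3') hU' hV
    · exact no_law_cube_e33_of_onto_z4z4 hρρ hρτ hτρ hττ hρ hτ hne hsurj φ hφ h hS' h3 (hT' ▸ h3) h3' (hU' ▸ h3') hV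
    · exact no_law_cube_3e3_of_onto_z4z4 hρρ hρτ hτρ hττ hρ hτ hne hsurj φ hφ h h3 (hS' ▸ h3) hT' h3' (hU' ▸ h3') hV
    · exact no_law_cube_three_five_of_onto_z4z4 hρρ hρτ hτρ hττ hρ hτ hne hsurj φ hφ h hS' hT' hU' h35 hV
    · exact no_law_cube_five_five_of_onto_z4z4 hρρ hρτ hτρ hττ hρ hτ hne hsurj φ hφ h hS' hT' hU' h55 hV
    · exact no_law_cube_seven_seven_of_onto_z4z4 hρρ hρτ hτρ hττ hρ hτ hne hsurj φ hφ h hS' hT' hU' h77 hV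
    · exact no_law_cube_three_seven_of_onto_z4z4 hρρ hρτ hτρ hττ hρ hτ hne hsurj φ hφ h hS' hT' hU' h37 hV
    · exact no_law_cube_three_nine_of_onto_z4z4 hρρ hρτ hτρ hττ hρ hτ hne hsurj φ hφ h hS' hT' hU' h39 hV
    · exact no_law_cube_five_seven_of_onto_z4z4 hρρ hρτ hτρ hττ hρ hτ hne hsurj φ hφ h hS' hT' hU' h57 hV
    · exact no_law_cube_five_nine_of_onto_z4z4 hρρ hρτ hτρ hττ hρ hτ hne hsurj φ hφ h hS' hT' hU' h59 hV
  · obtain ⟨g, a, b, hab⟩ :=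
      two_cosets_of_mod_one_law_of_not_cube hρρ hρτ hτρ hττ hρ hτ hne hsurj hmod hA h hV hnc
    exact not_two_cosets_of_onto_z4z4 φ hφ g a b hab

set_option synthInstance.maxHeartbeats 400000 in
set_option synthInstance.maxSize 4096 in
/-- **Finite check: every factorisation `cde` with `3cde + 1 < 2080`, `16 ∣ 3cde + 1` meets one of the nine escapes**
(`decide` over `cde ≤ 692`). [folklore] -/
theorem cube_factor_table_lt_2080 : ∀ c ∈ List.range 693, ∀ d ∈ List.range (692 / c + 1),
    ∀ e ∈ List.range (692 / (c * d) + 1), (3 * (c * d * e) + 1) % 16 = 0 → 3 * (c * d * e) + 1 < 2080 →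
      ((c = 1 ∨ d = 1 ∨ e = 1) ∨ ((c = 3 ∧ d = 3) ∨ (d = 3 ∧ e = 3) ∨ (c = 3 ∧ e = 3)) ∨
      ((c = 3 ∧ d = 5) ∨ (d = 3 ∧ e = 5) ∨ (e = 3 ∧ c = 5) ∨ (c = 5 ∧ d = 3) ∨ (d = 5 ∧ e = 3) ∨ (e = 5 ∧ c = 3)) ∨
      ((c = 5 ∧ d = 5) ∨ (d = 5 ∧ e = 5) ∨ (e = 5 ∧ c = 5)) ∨ ((c = 7 ∧ d = 7) ∨ (d = 7 ∧ e = 7) ∨ (e = 7 ∧ c = 7)) ∨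
      ((c = 3 ∧ d = 7) ∨ (d = 3 ∧ e = 7) ∨ (e = 3 ∧ c = 7) ∨ (c = 7 ∧ d = 3) ∨ (d = 7 ∧ e = 3) ∨ (e = 7 ∧ c = 3)) ∨
      ((c = 3 ∧ d = 9) ∨ (d = 3 ∧ e = 9) ∨ (e = 3 ∧ c = 9) ∨ (c = 9 ∧ d = 3) ∨ (d = 9 ∧ e = 3) ∨ (e = 9 ∧ c = 3)) ∨
      ((c = 5 ∧ d = 7) ∨ (d = 5 ∧ e = 7) ∨ (e = 5 ∧ c = 7) ∨ (c = 7 ∧ d = 5) ∨ (d = 7 ∧ e = 5) ∨ (e = 7 ∧ c = 5)) ∨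
      ((c = 5 ∧ d = 9) ∨ (d = 5 ∧ e = 9) ∨ (e = 5 ∧ c = 9) ∨ (c = 9 ∧ d = 5) ∨ (d = 9 ∧ e = 5) ∨ (e = 9 ∧ c = 5))) := by
  decide +kernel

/-- **Orders below `2080`.**  If `3cde + 1 = n < 2080` and `16 ∣ n`, then `(c, d, e)` meets one of the nine escapes (the first
order escaping is `2080 = 3·(3·11·21) + 1 = 3·(7·9·11) + 1`). [folklore] -/
theorem cube_factor_of_lt_2080 {c d e n : ℕ} (h : 3 * (c * d * e) + 1 = n) (hn : n < 2080) (h16 : 16 ∣ n) :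
      ((c = 1 ∨ d = 1 ∨ e = 1) ∨ ((c = 3 ∧ d = 3) ∨ (d = 3 ∧ e = 3) ∨ (c = 3 ∧ e = 3)) ∨
      ((c = 3 ∧ d = 5) ∨ (d = 3 ∧ e = 5) ∨ (e = 3 ∧ c = 5) ∨ (c = 5 ∧ d = 3) ∨ (d = 5 ∧ e = 3) ∨ (e = 5 ∧ c = 3)) ∨
      ((c = 5 ∧ d = 5) ∨ (d = 5 ∧ e = 5) ∨ (e = 5 ∧ c = 5)) ∨ ((c = 7 ∧ d = 7) ∨ (d = 7 ∧ e = 7) ∨ (e = 7 ∧ c = 7)) ∨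
      ((c = 3 ∧ d = 7) ∨ (d = 3 ∧ e = 7) ∨ (e = 3 ∧ c = 7) ∨ (c = 7 ∧ d = 3) ∨ (d = 7 ∧ e = 3) ∨ (e = 7 ∧ c = 3)) ∨
      ((c = 3 ∧ d = 9) ∨ (d = 3 ∧ e = 9) ∨ (e = 3 ∧ c = 9) ∨ (c = 9 ∧ d = 3) ∨ (d = 9 ∧ e = 3) ∨ (e = 9 ∧ c = 3)) ∨
      ((c = 5 ∧ d = 7) ∨ (d = 5 ∧ e = 7) ∨ (e = 5 ∧ c = 7) ∨ (c = 7 ∧ d = 5) ∨ (d = 7 ∧ e = 5) ∨ (e = 7 ∧ c = 5)) ∨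
      ((c = 5 ∧ d = 9) ∨ (d = 5 ∧ e = 9) ∨ (e = 5 ∧ c = 9) ∨ (c = 9 ∧ d = 5) ∨ (d = 9 ∧ e = 5) ∨ (e = 9 ∧ c = 5))) := by
  subst h
  have hm : c * d * e ≤ 692 := by omega
  have hc0 : c ≠ 0 := by rintro rfl; simp at h16
  have hd0 : d ≠ 0 := by rintro rfl; simp at h16
  have he0 : e ≠ 0 := by rintro rfl; simp at h16
  have hc : c < 693 := by
    have : c ≤ c * d * e := by
      calc c = c * 1 * 1 := by ring
        _ ≤ c * d * e := by gcongr <;> omega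
    omega
  have hd : d < 692 / c + 1 := by
    rw [Nat.lt_add_one_iff, Nat.le_div_iff_mul_le (Nat.pos_of_ne_zero hc0)]
    calc d * c = c * d * 1 := by ring
      _ ≤ c * d * e := by gcongr; omega
      _ ≤ 692 := hm
  have he : e < 692 / (c * d) + 1 := by
    rw [Nat.lt_add_one_iff, Nat.le_div_iff_mul_le (Nat.pos_of_ne_zero (mul_ne_zero hc0 hd0))]
    calc e * (c * d) = c * d * e := by ring
      _ ≤ 692 := hm
  exact cube_factor_table_lt_2080 c (List.mem_range.2 hc) d (List.mem_range.2 hd) e (List.mem_range.2 he)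
    (Nat.mod_eq_zero_of_dvd h16) (by omega)

/-- **THE `ℤ₄²`-QUOTIENT COLUMN BELOW `2080`.**  Let `A` be a finite abelian group with a surjection `φ : A →+ ZMod 4 × ZMod 4`
and `|A| < 2080`.  Then no dihedral-like group over `A` (any `c₀`) has a TPP triple attaining `3|S||T||U| + 8 = 8|A|`.
[folklore] -/
theorem no_mod_one_law_of_onto_z4z4_card_lt_2080
    (hρρ : ∀ a b, ρ a * ρ b = ρ (a + b)) (hρτ : ∀ a b, ρ a * τ b = τ (b - a))
    (hτρ : ∀ a b, τ a * ρ b = τ (a + b)) (hττ : ∀ a b, τ a * τ b = ρ (c₀ + b - a))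
    (hρ : Function.Injective ρ) (hτ : Function.Injective τ) (hne : ∀ a b, ρ a ≠ τ b)
    (hsurj : ∀ g, (∃ a, ρ a = g) ∨ (∃ a, τ a = g))
    (φ : A →+ ZMod 4 × ZMod 4) (hφ : Function.Surjective φ) (hA : Fintype.card A < 2080)
    (h : TripleProductProperty S T U) : 3 * (S.card * T.card * U.card) + 8 ≠ 8 * Fintype.card A := by
  have h16 : Fintype.card (ZMod 4 × ZMod 4) ∣ Fintype.card A := by
    rw [← Nat.card_eq_fintype_card, ← Nat.card_eq_fintype_card]
    exact AddSubgroup.card_dvd_of_surjective φ hφ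
  have hc16 : Fintype.card (ZMod 4 × ZMod 4) = 16 := by simp
  rw [hc16] at h16
  have hpos : 0 < Fintype.card A := Fintype.card_pos
  have hA14 : 14 ≤ Fintype.card A := by obtain ⟨k, hk⟩ := h16; omega
  exact no_mod_one_law_of_onto_z4z4_nine_escapes hρρ hρτ hτρ hττ hρ hτ hne hsurj hA14 φ hφ
    (fun c d e hcde => cube_factor_of_lt_2080 hcde hA h16) h

end DihedralLike

/-! ## Instances: the newly closed orders `1072`, `1216`, `2032` as named groups -/

section Instances

variable {G : Type} [Group G] [DecidableEq G] {S T U : Finset G}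

open Literature.Combinatorics.Additive

/-- **`ℤ₄ × ℤ₄ × ℤ₆₇` (order `1072 = 3·(3·7·17)+1`, the first order beyond `ThreeSetZ4Z4Orders.lean`)**: no dihedral-like group over
it (any `c₀`) has a TPP triple with `3|S||T||U| + 8 = 8 · 1072`. [folklore] -/
theorem no_mod_one_law_z4_z4_z67 {ρ τ : ZMod 4 × (ZMod 4 × ZMod 67) → G} {c₀ : ZMod 4 × (ZMod 4 × ZMod 67)}
    (hρρ : ∀ a b, ρ a * ρ b = ρ (a + b)) (hρτ : ∀ a b, ρ a * τ b = τ (b - a))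
    (hτρ : ∀ a b, τ a * ρ b = τ (a + b)) (hττ : ∀ a b, τ a * τ b = ρ (c₀ + b - a))
    (hρ : Function.Injective ρ) (hτ : Function.Injective τ) (hne : ∀ a b, ρ a ≠ τ b)
    (hsurj : ∀ g, (∃ a, ρ a = g) ∨ (∃ a, τ a = g)) (h : TripleProductProperty S T U) :
    3 * (S.card * T.card * U.card) + 8 ≠ 8 * Fintype.card (ZMod 4 × (ZMod 4 × ZMod 67)) :=
  no_mod_one_law_of_onto_z4z4_card_lt_2080 hρρ hρτ hτρ hττ hρ hτ hne hsurj _ (z4_z4_zn_onto_z4z4 67) (by simp) h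

/-- **`ℤ₄ × ℤ₃₀₄` (`≅ ℤ₄ × ℤ₁₆ × ℤ₁₉`, order `1216 = 3·405+1`, shapes `(3,9,15)`, `(5,9,9)`, `(3,3,45)`, `(3,5,27)`)**: no
dihedral-like group over it (any `c₀`) has a TPP triple with `3|S||T||U| + 8 = 8 · 1216`. [folklore] -/
theorem no_mod_one_law_z4_z304 {ρ τ : ZMod 4 × ZMod 304 → G} {c₀ : ZMod 4 × ZMod 304}
    (hρρ : ∀ a b, ρ a * ρ b = ρ (a + b)) (hρτ : ∀ a b, ρ a * τ b = τ (b - a))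
    (hτρ : ∀ a b, τ a * ρ b = τ (a + b)) (hττ : ∀ a b, τ a * τ b = ρ (c₀ + b - a))
    (hρ : Function.Injective ρ) (hτ : Function.Injective τ) (hne : ∀ a b, ρ a ≠ τ b)
    (hsurj : ∀ g, (∃ a, ρ a = g) ∨ (∃ a, τ a = g)) (h : TripleProductProperty S T U) :
    3 * (S.card * T.card * U.card) + 8 ≠ 8 * Fintype.card (ZMod 4 × ZMod 304) :=
  no_mod_one_law_of_onto_z4z4_card_lt_2080 hρρ hρτ hτρ hττ hρ hτ hne hsurj _
    (zm_zn_onto_z4z4 (by norm_num) (by norm_num)) (by simp) h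

/-- **`ℤ₈ × ℤ₁₅₂` (`≅ ℤ₈ × ℤ₈ × ℤ₁₉`, order `1216`)**: no dihedral-like group over it (any `c₀`) has a TPP triple with
`3|S||T||U| + 8 = 8 · 1216`. [folklore] -/
theorem no_mod_one_law_z8_z152 {ρ τ : ZMod 8 × ZMod 152 → G} {c₀ : ZMod 8 × ZMod 152}
    (hρρ : ∀ a b, ρ a * ρ b = ρ (a + b)) (hρτ : ∀ a b, ρ a * τ b = τ (b - a))
    (hτρ : ∀ a b, τ a * ρ b = τ (a + b)) (hττ : ∀ a b, τ a * τ b = ρ (c₀ + b - a))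
    (hρ : Function.Injective ρ) (hτ : Function.Injective τ) (hne : ∀ a b, ρ a ≠ τ b)
    (hsurj : ∀ g, (∃ a, ρ a = g) ∨ (∃ a, τ a = g)) (h : TripleProductProperty S T U) :
    3 * (S.card * T.card * U.card) + 8 ≠ 8 * Fintype.card (ZMod 8 × ZMod 152) :=
  no_mod_one_law_of_onto_z4z4_card_lt_2080 hρρ hρτ hτρ hττ hρ hτ hne hsurj _
    (zm_zn_onto_z4z4 (by norm_num) (by norm_num)) (by simp) h

/-- **`ℤ₄ × ℤ₄ × ℤ₁₂₇` (order `2032`, the last order `16 ∣ n ≡ 1 (mod 3)` below `2080`)**: no dihedral-like group over it (any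
`c₀`) has a TPP triple with `3|S||T||U| + 8 = 8 · 2032`. [folklore] -/
theorem no_mod_one_law_z4_z4_z127 {ρ τ : ZMod 4 × (ZMod 4 × ZMod 127) → G} {c₀ : ZMod 4 × (ZMod 4 × ZMod 127)}
    (hρρ : ∀ a b, ρ a * ρ b = ρ (a + b)) (hρτ : ∀ a b, ρ a * τ b = τ (b - a))
    (hτρ : ∀ a b, τ a * ρ b = τ (a + b)) (hττ : ∀ a b, τ a * τ b = ρ (c₀ + b - a))
    (hρ : Function.Injective ρ) (hτ : Function.Injective τ) (hne : ∀ a b, ρ a ≠ τ b)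
    (hsurj : ∀ g, (∃ a, ρ a = g) ∨ (∃ a, τ a = g)) (h : TripleProductProperty S T U) :
    3 * (S.card * T.card * U.card) + 8 ≠ 8 * Fintype.card (ZMod 4 × (ZMod 4 × ZMod 127)) :=
  no_mod_one_law_of_onto_z4z4_card_lt_2080 hρρ hρτ hτρ hττ hρ hτ hne hsurj _ (z4_z4_zn_onto_z4z4 127) (by simp) h

end Instances

end Summit.MatrixMultiplication.OmegaCensus
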